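import Summits.AtomisticToContinuum.BoseEinsteinCondensation.Theorems.BECHardSphereReductionHardSphereBECStubSectorOccupation
import Literature.MathematicalPhysics.QuantumManyBody.GroundStateDirichletForm
import HarnessLib

/-!
# Crux `HardSphereBEC` (stmt-AtomisticToContinuum-11885), line `birth` (skeleton v5):
# preliminaries for the registered stub `stub_sectorTransfer_of` (T3)

Supports (does not close) stmt-AtomisticToContinuum-11885; helper file (namespace `SectorTransfer`)
for the stub `stub_sectorTransfer_of` of the birth line (lead c8, skeleton v5), proved in
`BECHardSphereReductionHardSphereBECStubSectorTransferOf`. Elementary facts about the flat-mode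
occupation `occ₀ = ⟨φ₀, γ_· φ₀⟩`, `φ₀ = L^{-3/2}·1_{Λ_L}`, and about the smoothed phase sectors
`G_j` of a trial state `Ψ` (as produced by T2, `stub_smoothSectors`):

* `occupation_const_mul` — homogeneity `occ(aF) = |a|² occ(F)`;
* `occupation_flatMode_mono` — monotonicity of `occ₀` in a real nonnegative function
  (`0 ≤ G ≤ p ⟹ occ₀(G) ≤ occ₀(p)`, since `φ₀ ≥ 0`: `SectorOccupation.occupation_flatMode_eq`);
* `sum_rawEnergy_le_energy` — the raw energies `R_j = ∫(|∇G_j|² + V|G_j|²)` of functions dominated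
  IN SUM by `Ψ` add up to at most `energy v Ψ`, for every profile `v` (superadditivity of `∫⁻`);
* `exists_normalised`, `groundStateEnergy_mul_mass_le`, `mass_mul_le_occupation` — normalising a
  `C¹`, Bose-symmetric, real nonnegative `G` vanishing where `Ψ` does into a trial state
  `A^{-1/2} G` (`A = ∫|G|²`; the construction of
  `PositiveNearMinimiserExists.exists_trialState_of_dominated`), whence the variational bound
  `E₀ A ≤ R` and the transfer `R ≤ A (E₀ + δ) ⟹ A · C ≤ occ(G)` of a hypothesis
  `C ≤ occ(Φ)` on nonnegative `δ`-near-minimisers `Φ`;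
* `one_le_sum_mass_add` — the mass deficit `1 ≤ Σ_j ∫|G_j|² + ε(4|Λ_L^N| + 1)` when
  `G_j ≤ P_j ≤ G_j + ε` for the four phase sectors `P = ((Re Ψ)⁺, (Re Ψ)⁻, (Im Ψ)⁺, (Im Ψ)⁻)`
  (`P_j² − G_j² ≤ ε(1 + P_j²)` and `Σ_j P_j² = |Ψ|²`); restated in closed form as the registered
  sub-goal `stub_sectorMassDeficit` (T3a) of the crux item, which this file discharges.
-/

noncomputable section

open MeasureTheory
open scoped ENNReal NNReal ComplexConjugate

namespace Summit.AtomisticToContinuum.BoseEinsteinCondensation.Cruxes.HardSphereBEC.Birth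

open Literature.MathematicalPhysics.QuantumManyBody.BoseGas

namespace SectorTransfer

variable {N : ℕ} {L : ℝ}

/-! ### Homogeneity and monotonicity of the occupation -/

/-- **Homogeneity**: `⟨φ, γ_{aF} φ⟩ = |a|² ⟨φ, γ_F φ⟩`. [folklore] -/
theorem occupation_const_mul (N : ℕ) (φ : Space → ℂ) (a : ℂ) (F : Config N → ℂ) :
    occupation N φ (fun X => a * F X) = ((‖a‖₊ : ℝ≥0∞)) ^ 2 * occupation N φ F := by
  cases N with
  | zero => simp [occupation]
  | succ n =>
    change (n + 1 : ℝ≥0∞) * ∫⁻ Y : Config n,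
        (‖∫ x, conj (φ x) * (a * F (Matrix.vecCons x Y))‖₊ : ℝ≥0∞) ^ 2 =
      ((‖a‖₊ : ℝ≥0∞)) ^ 2 * ((n + 1 : ℝ≥0∞) * ∫⁻ Y : Config n,
        (‖∫ x, conj (φ x) * F (Matrix.vecCons x Y)‖₊ : ℝ≥0∞) ^ 2)
    have h : ∀ Y : Config n, ∫ x, conj (φ x) * (a * F (Matrix.vecCons x Y)) =
        a * ∫ x, conj (φ x) * F (Matrix.vecCons x Y) := by
      intro Y
      rw [← integral_const_mul]
      exact integral_congr_ae (Filter.Eventually.of_forall fun x => by ring)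
    simp_rw [h, nnnorm_mul, ENNReal.coe_mul, mul_pow]
    rw [lintegral_const_mul' _ _ (ENNReal.pow_ne_top ENNReal.coe_ne_top), mul_left_comm]

/-- The slice `x ↦ p(x, Y)` of a real function vanishing off `Λ_L^{n+1}` vanishes off `Λ_L`.
[folklore] -/
theorem slice_eq_zero_real {n : ℕ} {p : Config (n + 1) → ℝ}
    (hp : ∀ X, X ∉ boxN (n + 1) L → p X = 0) (Y : Config n) {x : Space} (hx : x ∉ box L) :
    p (Matrix.vecCons x Y) = 0 :=
  hp _ fun h => hx (by simpa using h 0)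

/-- **Monotonicity of the flat-mode occupation in a real nonnegative function**: if
`0 ≤ G ≤ p` pointwise (`G` real nonnegative and continuous, `p` continuous and vanishing off
`Λ_L^N`, `L > 0`), then `⟨φ₀, γ_G φ₀⟩ ≤ ⟨φ₀, γ_p φ₀⟩`, because `φ₀ ≥ 0` makes both slice integrals
nonnegative reals, ordered. [folklore] -/
theorem occupation_flatMode_mono (hL : 0 < L) {G : Config N → ℂ} {p : Config N → ℝ}
    (hG : Continuous G) (hp : Continuous p) (hGreal : ∀ X, G X = (‖G X‖ : ℂ))
    (hGp : ∀ X, ‖G X‖ ≤ p X) (hp0 : ∀ X, X ∉ boxN N L → p X = 0) :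
    occupation N ((box L).indicator fun _ => ((Real.sqrt (L ^ 3))⁻¹ : ℂ)) G ≤
      occupation N ((box L).indicator fun _ => ((Real.sqrt (L ^ 3))⁻¹ : ℂ))
        (fun X => ((p X : ℝ) : ℂ)) := by
  cases N with
  | zero => simp [occupation]
  | succ n =>
    have hGf : G = fun X => ((‖G X‖ : ℝ) : ℂ) := funext hGreal
    have hg0 : ∀ X, X ∉ boxN (n + 1) L → ‖G X‖ = 0 := fun X hX =>
      le_antisymm ((hGp X).trans_eq (hp0 X hX)) (norm_nonneg _)
    have hGc : ∀ X, X ∉ boxN (n + 1) L → (fun X => ((‖G X‖ : ℝ) : ℂ)) X = 0 := fun X hX => by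
      simp [hg0 X hX]
    have hpc : ∀ X, X ∉ boxN (n + 1) L → (fun X => ((p X : ℝ) : ℂ)) X = 0 := fun X hX => by
      simp [hp0 X hX]
    rw [hGf, SectorOccupation.occupation_flatMode_eq hL hGc,
      SectorOccupation.occupation_flatMode_eq hL hpc]
    refine mul_le_mul' le_rfl (mul_le_mul' le_rfl (lintegral_mono fun Y => ?_))
    have hgn : Continuous fun X => ‖G X‖ := continuous_norm.comp hG
    have hsl : Continuous fun x : Space => Matrix.vecCons x Y :=
      continuous_id.matrixVecCons continuous_const
    have hgi : Integrable fun x => ‖G (Matrix.vecCons x Y)‖ :=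
      SectorOccupation.integrable_of_box (hgn.comp hsl) fun x hx =>
        slice_eq_zero_real (p := fun X => ‖G X‖) hg0 Y hx
    have hpi : Integrable fun x => p (Matrix.vecCons x Y) :=
      SectorOccupation.integrable_of_box (hp.comp hsl) fun x hx => slice_eq_zero_real hp0 Y hx
    have h0 : 0 ≤ ∫ x, ‖G (Matrix.vecCons x Y)‖ := integral_nonneg fun x => norm_nonneg _
    have h1 : ∫ x, ‖G (Matrix.vecCons x Y)‖ ≤ ∫ x, p (Matrix.vecCons x Y) :=
      integral_mono hgi hpi fun x => hGp _
    show ((‖∫ x, ((‖G (Matrix.vecCons x Y)‖ : ℝ) : ℂ)‖₊ : ℝ≥0∞)) ^ 2 ≤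
      ((‖∫ x, ((p (Matrix.vecCons x Y) : ℝ) : ℂ)‖₊ : ℝ≥0∞)) ^ 2
    rw [SectorOccupation.coe_nnnorm_integral_ofReal_sq (fun x => ‖G (Matrix.vecCons x Y)‖),
      SectorOccupation.coe_nnnorm_integral_ofReal_sq (fun x => p (Matrix.vecCons x Y))]
    exact ENNReal.ofReal_le_ofReal (pow_le_pow_left₀ h0 h1 2)

/-! ### Raw energies of the smoothed sectors -/

/-- Superadditivity of the lower Lebesgue integral over four summands (no measurability).
[folklore] -/
theorem sum_four_lintegral_le {α : Type*} [MeasurableSpace α] {μ : Measure α}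
    (f : Fin 4 → α → ℝ≥0∞) : ∑ j, ∫⁻ a, f j a ∂μ ≤ ∫⁻ a, ∑ j, f j a ∂μ := by
  simp only [Fin.sum_univ_four]
  calc ∫⁻ a, f 0 a ∂μ + ∫⁻ a, f 1 a ∂μ + ∫⁻ a, f 2 a ∂μ + ∫⁻ a, f 3 a ∂μ
      ≤ ∫⁻ a, (f 0 a + f 1 a) ∂μ + ∫⁻ a, f 2 a ∂μ + ∫⁻ a, f 3 a ∂μ := by
        gcongr ?_ + _ + _
        exact le_lintegral_add _ _
    _ ≤ ∫⁻ a, (f 0 a + f 1 a + f 2 a) ∂μ + ∫⁻ a, f 3 a ∂μ := by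
        gcongr ?_ + _
        exact le_lintegral_add _ _
    _ ≤ _ := le_lintegral_add _ _

/-- **Raw energies add up below the energy**: if `Σ_j |∇G_j|² ≤ |∇Ψ|²` and `Σ_j |G_j|² ≤ |Ψ|²`
pointwise, then `Σ_j ∫(|∇G_j|² + V|G_j|²) ≤ energy v Ψ` for every profile `v` (pointwise
`Σ_j V|G_j|² = V Σ_j|G_j|²`; only monotonicity and superadditivity of `∫⁻`). [folklore] -/
theorem sum_rawEnergy_le_energy (v : ℝ → ℝ≥0∞) (Ψ : TrialState N L)
    {G : Fin 4 → Config N → ℂ}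
    (hkin : ∀ X, ∑ j, kineticDensity (G j) X ≤ kineticDensity Ψ.ψ X)
    (hsq : ∀ X, ∑ j, ((‖G j X‖₊ : ℝ≥0∞)) ^ 2 ≤ ((‖Ψ.ψ X‖₊ : ℝ≥0∞)) ^ 2) :
    ∑ j, ∫⁻ X, (kineticDensity (G j) X + interaction v X * ((‖G j X‖₊ : ℝ≥0∞)) ^ 2) ≤
      energy v Ψ :=
  calc ∑ j, ∫⁻ X, (kineticDensity (G j) X + interaction v X * ((‖G j X‖₊ : ℝ≥0∞)) ^ 2)
      ≤ ∫⁻ X, ∑ j, (kineticDensity (G j) X + interaction v X * ((‖G j X‖₊ : ℝ≥0∞)) ^ 2) :=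
        sum_four_lintegral_le _
    _ ≤ ∫⁻ X, (kineticDensity Ψ.ψ X + interaction v X * ((‖Ψ.ψ X‖₊ : ℝ≥0∞)) ^ 2) := by
        refine lintegral_mono fun X => ?_
        rw [Finset.sum_add_distrib, ← Finset.mul_sum]
        exact add_le_add (hkin X) (mul_le_mul' le_rfl (hsq X))
    _ = energy v Ψ := rfl

/-! ### Normalising a smoothed sector -/

/-- **Normalisation.** For `G` of class `C¹`, vanishing where `Ψ` does, Bose-symmetric and real
nonnegative, with `A = ∫|G|² ∉ {0, ⊤}`: `Φ = A^{-1/2} G ∈ TrialState N L` and `Φ ≥ 0`; the constant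
`k = A^{-1/2}` is returned with `k² A = 1` and `Φ = k G`
(cf. `PositiveNearMinimiserExists.exists_trialState_of_dominated`). [folklore] -/
theorem exists_normalised (Ψ : TrialState N L) {G : Config N → ℂ} (hG : ContDiff ℝ 1 G)
    (hG0 : ∀ X, Ψ.ψ X = 0 → G X = 0)
    (hGsymm : ∀ (σ : Equiv.Perm (Fin N)) (X : Config N), G (X ∘ σ) = G X)
    (hGreal : ∀ X, G X = (‖G X‖ : ℂ))
    (hA0 : ∫⁻ X, ((‖G X‖₊ : ℝ≥0∞)) ^ 2 ≠ 0) (hAtop : ∫⁻ X, ((‖G X‖₊ : ℝ≥0∞)) ^ 2 ≠ ⊤) :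
    ∃ (k : ℝ≥0) (Φ : TrialState N L), ((k : ℝ≥0∞)) ^ 2 * ∫⁻ X, ((‖G X‖₊ : ℝ≥0∞)) ^ 2 = 1 ∧
      (Φ.ψ = fun X => (k : ℂ) * G X) ∧ ∀ X, Φ.ψ X = (‖Φ.ψ X‖ : ℂ) := by
  set A : ℝ≥0∞ := ∫⁻ X, ((‖G X‖₊ : ℝ≥0∞)) ^ 2 with hA
  have hmeas : Measurable (fun X => ((‖G X‖₊ : ℝ≥0∞)) ^ 2) :=
    (hG.continuous.measurable.nnnorm.coe_nnreal_ennreal).pow_const 2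
  let k : ℝ≥0 := NNReal.sqrt (A.toNNReal)⁻¹
  have hk : ((k : ℝ≥0∞)) ^ 2 * A = 1 := by
    rw [← ENNReal.coe_pow, NNReal.sq_sqrt,
      ENNReal.coe_inv (ENNReal.toNNReal_ne_zero.2 ⟨hA0, hAtop⟩), ENNReal.coe_toNNReal hAtop,
      ENNReal.inv_mul_cancel hA0 hAtop]
  have hknorm : ((‖(k : ℂ)‖₊ : ℝ≥0∞)) = (k : ℝ≥0∞) := by simp
  have hsqk : ∀ X, ((‖(k : ℂ) * G X‖₊ : ℝ≥0∞)) ^ 2 =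
      ((k : ℝ≥0∞)) ^ 2 * ((‖G X‖₊ : ℝ≥0∞)) ^ 2 := by
    intro X
    rw [nnnorm_mul, ENNReal.coe_mul, mul_pow, hknorm]
  refine ⟨k, ⟨fun X => (k : ℂ) * G X, contDiff_const.mul hG, ?_, ?_, ?_⟩, hk, rfl, ?_⟩
  · intro X hX
    show (k : ℂ) * G X = 0
    rw [hG0 X (Ψ.eq_zero X hX), mul_zero]
  · intro σ X
    show (k : ℂ) * G (X ∘ σ) = (k : ℂ) * G X
    rw [hGsymm]
  · show ∫⁻ X, ((‖(k : ℂ) * G X‖₊ : ℝ≥0∞)) ^ 2 = 1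
    simp_rw [hsqk]
    rw [lintegral_const_mul _ hmeas, hk]
  · intro X
    show (k : ℂ) * G X = (‖(k : ℂ) * G X‖ : ℂ)
    rw [hGreal X]
    have h0 : 0 ≤ (k : ℝ) * ‖G X‖ := mul_nonneg k.coe_nonneg (norm_nonneg _)
    rw [show ((k : ℂ)) * ((‖G X‖ : ℝ) : ℂ) = (((k : ℝ) * ‖G X‖ : ℝ) : ℂ) by push_cast; rfl,
      Complex.norm_real, Real.norm_of_nonneg h0]

/-- Energy of a scaled function: `energy (kG) = k² ∫(|∇G|² + V|G|²)` (pull the finite constant out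
of the lower integral). [folklore] -/
theorem energy_eq_of_eq_const_mul (v : ℝ → ℝ≥0∞) (Φ : TrialState N L) {k : ℝ≥0}
    {G : Config N → ℂ} (h : Φ.ψ = fun X => (k : ℂ) * G X) :
    energy v Φ = ((k : ℝ≥0∞)) ^ 2 *
      ∫⁻ X, (kineticDensity G X + interaction v X * ((‖G X‖₊ : ℝ≥0∞)) ^ 2) := by
  have hknorm : ((‖(k : ℂ)‖₊ : ℝ≥0∞)) = (k : ℝ≥0∞) := by simp
  unfold energy
  rw [h, ← lintegral_const_mul' _ _ (ENNReal.pow_ne_top ENNReal.coe_ne_top)]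
  refine lintegral_congr fun X => ?_
  show kineticDensity (fun Y => (k : ℂ) * G Y) X +
      interaction v X * ((‖(k : ℂ) * G X‖₊ : ℝ≥0∞)) ^ 2 = _
  rw [kineticDensity_const_mul_complex, nnnorm_mul, ENNReal.coe_mul, mul_pow, hknorm, mul_add,
    mul_left_comm]

/-- **Variational bound on a sector**: `E₀ · ∫|G|² ≤ ∫(|∇G|² + V|G|²)` for `G` as above
(normalise and use `E₀ ≤ energy`; trivial if `∫|G|² = 0`). [folklore] -/
theorem groundStateEnergy_mul_mass_le (v : ℝ → ℝ≥0∞) (Ψ : TrialState N L) {G : Config N → ℂ}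
    (hG : ContDiff ℝ 1 G) (hG0 : ∀ X, Ψ.ψ X = 0 → G X = 0)
    (hGsymm : ∀ (σ : Equiv.Perm (Fin N)) (X : Config N), G (X ∘ σ) = G X)
    (hGreal : ∀ X, G X = (‖G X‖ : ℂ)) (hAtop : ∫⁻ X, ((‖G X‖₊ : ℝ≥0∞)) ^ 2 ≠ ⊤) :
    groundStateEnergy v N L * ∫⁻ X, ((‖G X‖₊ : ℝ≥0∞)) ^ 2 ≤
      ∫⁻ X, (kineticDensity G X + interaction v X * ((‖G X‖₊ : ℝ≥0∞)) ^ 2) := by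
  by_cases hA0 : ∫⁻ X, ((‖G X‖₊ : ℝ≥0∞)) ^ 2 = 0
  · rw [hA0, mul_zero]
    exact bot_le
  obtain ⟨k, Φ, hk, hΦ, -⟩ := exists_normalised Ψ hG hG0 hGsymm hGreal hA0 hAtop
  have hE := (groundStateEnergy_le_energy v Φ).trans_eq (energy_eq_of_eq_const_mul v Φ hΦ)
  calc groundStateEnergy v N L * ∫⁻ X, ((‖G X‖₊ : ℝ≥0∞)) ^ 2
      ≤ ((k : ℝ≥0∞)) ^ 2 *
          (∫⁻ X, (kineticDensity G X + interaction v X * ((‖G X‖₊ : ℝ≥0∞)) ^ 2)) *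
          ∫⁻ X, ((‖G X‖₊ : ℝ≥0∞)) ^ 2 := mul_le_mul' hE le_rfl
    _ = ((k : ℝ≥0∞)) ^ 2 * (∫⁻ X, ((‖G X‖₊ : ℝ≥0∞)) ^ 2) *
          ∫⁻ X, (kineticDensity G X + interaction v X * ((‖G X‖₊ : ℝ≥0∞)) ^ 2) := by ring
    _ = _ := by rw [hk, one_mul]

/-- **Transfer of the hypothesis to a sector**: if nonnegative `δ`-near-minimisers have
`C ≤ ⟨φ, γ φ⟩`, and the raw energy of `G` is at most `∫|G|² · (E₀ + δ)` with `∫|G|² ∉ {0, ⊤}`,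
then `∫|G|² · C ≤ ⟨φ, γ_G φ⟩` (normalise, apply, un-normalise by homogeneity). [folklore] -/
theorem mass_mul_le_occupation (v : ℝ → ℝ≥0∞) (Ψ : TrialState N L) {G : Config N → ℂ}
    (hG : ContDiff ℝ 1 G) (hG0 : ∀ X, Ψ.ψ X = 0 → G X = 0)
    (hGsymm : ∀ (σ : Equiv.Perm (Fin N)) (X : Config N), G (X ∘ σ) = G X)
    (hGreal : ∀ X, G X = (‖G X‖ : ℂ)) (hA0 : ∫⁻ X, ((‖G X‖₊ : ℝ≥0∞)) ^ 2 ≠ 0)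
    (hAtop : ∫⁻ X, ((‖G X‖₊ : ℝ≥0∞)) ^ 2 ≠ ⊤) (φ : Space → ℂ) {δ C : ℝ≥0∞}
    (HYP : ∀ Φ : TrialState N L, energy v Φ ≤ groundStateEnergy v N L + δ →
      (∀ X, Φ.ψ X = (‖Φ.ψ X‖ : ℂ)) → C ≤ occupation N φ Φ.ψ)
    (hR : ∫⁻ X, (kineticDensity G X + interaction v X * ((‖G X‖₊ : ℝ≥0∞)) ^ 2) ≤
      (∫⁻ X, ((‖G X‖₊ : ℝ≥0∞)) ^ 2) * (groundStateEnergy v N L + δ)) :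
    (∫⁻ X, ((‖G X‖₊ : ℝ≥0∞)) ^ 2) * C ≤ occupation N φ G := by
  obtain ⟨k, Φ, hk, hΦ, hΦpos⟩ := exists_normalised Ψ hG hG0 hGsymm hGreal hA0 hAtop
  have hknorm : ((‖(k : ℂ)‖₊ : ℝ≥0∞)) = (k : ℝ≥0∞) := by simp
  have hnear : energy v Φ ≤ groundStateEnergy v N L + δ := by
    rw [energy_eq_of_eq_const_mul v Φ hΦ]
    calc ((k : ℝ≥0∞)) ^ 2 *
          ∫⁻ X, (kineticDensity G X + interaction v X * ((‖G X‖₊ : ℝ≥0∞)) ^ 2)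
        ≤ ((k : ℝ≥0∞)) ^ 2 *
            ((∫⁻ X, ((‖G X‖₊ : ℝ≥0∞)) ^ 2) * (groundStateEnergy v N L + δ)) :=
          mul_le_mul' le_rfl hR
      _ = ((k : ℝ≥0∞)) ^ 2 * (∫⁻ X, ((‖G X‖₊ : ℝ≥0∞)) ^ 2) *
            (groundStateEnergy v N L + δ) := (mul_assoc _ _ _).symm
      _ = _ := by rw [hk, one_mul]
  have hocc := HYP Φ hnear hΦpos
  rw [hΦ, occupation_const_mul, hknorm] at hocc
  calc (∫⁻ X, ((‖G X‖₊ : ℝ≥0∞)) ^ 2) * C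
      ≤ (∫⁻ X, ((‖G X‖₊ : ℝ≥0∞)) ^ 2) * (((k : ℝ≥0∞)) ^ 2 * occupation N φ G) :=
        mul_le_mul' le_rfl hocc
    _ = ((k : ℝ≥0∞)) ^ 2 * (∫⁻ X, ((‖G X‖₊ : ℝ≥0∞)) ^ 2) * occupation N φ G := by ring
    _ = _ := by rw [hk, one_mul]

/-! ### The mass deficit -/

/-- `Σ_j P_j(z)² = |z|²` for the four phase sectors of `z ∈ ℂ`:
`((Re z)⁺)² + ((Re z)⁻)² + ((Im z)⁺)² + ((Im z)⁻)² = |z|²` (one of `a⁺, a⁻` vanishes). [folklore] -/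
theorem sum_sector_sq_eq_normSq (z : ℂ) :
    (max z.re 0) ^ 2 + (max (-z.re) 0) ^ 2 + (max z.im 0) ^ 2 + (max (-z.im) 0) ^ 2 =
      ‖z‖ ^ 2 := by
  have key : ∀ a : ℝ, (max a 0) ^ 2 + (max (-a) 0) ^ 2 = a ^ 2 := fun a => by
    rcases le_total 0 a with ha | ha
    · rw [max_eq_left ha, max_eq_right (neg_nonpos.2 ha)]
      ring
    · rw [max_eq_right ha, max_eq_left (neg_nonneg.2 ha)]
      ring
  calc (max z.re 0) ^ 2 + (max (-z.re) 0) ^ 2 + (max z.im 0) ^ 2 + (max (-z.im) 0) ^ 2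
      = ((max z.re 0) ^ 2 + (max (-z.re) 0) ^ 2) + ((max z.im 0) ^ 2 + (max (-z.im) 0) ^ 2) := by
        ring
    _ = z.re ^ 2 + z.im ^ 2 := by rw [key, key]
    _ = ‖z‖ ^ 2 := by
        rw [Complex.sq_norm, Complex.normSq_apply]
        ring

/-- One sector: `0 ≤ g ≤ P ≤ g + ε` with `P ≥ 0` gives `P² ≤ g² + ε(1 + P²)`
(`P² − g² = (P − g)(P + g) ≤ ε · 2P ≤ ε(1 + P²)`). [folklore] -/
theorem sq_le_sq_add_of_squeeze {g P ε : ℝ} (hg : 0 ≤ g) (hP : 0 ≤ P) (hgP : g ≤ P)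
    (hPg : P ≤ g + ε) : P ^ 2 ≤ g ^ 2 + ε * (1 + P ^ 2) := by
  have hε : 0 ≤ ε := by linarith
  nlinarith [mul_le_mul_of_nonneg_right (sub_le_iff_le_add'.2 hPg) (add_nonneg hP hg),
    sq_nonneg (P - 1), mul_le_mul_of_nonneg_left hgP hε, mul_nonneg hε hP]

/-- Four sectors of `z ∈ ℂ`: if `0 ≤ g_j ≤ P_j(z) ≤ g_j + ε` for the phase sectors
`P = ((Re z)⁺, (Re z)⁻, (Im z)⁺, (Im z)⁻)`, then `|z|² ≤ Σ_j g_j² + ε(4 + |z|²)`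
(`Σ_j P_j² = |z|²`). [folklore] -/
theorem normSq_le_of_squeeze (z : ℂ) {g₀ g₁ g₂ g₃ ε : ℝ} (hg₀ : 0 ≤ g₀) (hg₁ : 0 ≤ g₁)
    (hg₂ : 0 ≤ g₂) (hg₃ : 0 ≤ g₃) (h₀ : g₀ ≤ max z.re 0 ∧ max z.re 0 ≤ g₀ + ε)
    (h₁ : g₁ ≤ max (-z.re) 0 ∧ max (-z.re) 0 ≤ g₁ + ε)
    (h₂ : g₂ ≤ max z.im 0 ∧ max z.im 0 ≤ g₂ + ε)
    (h₃ : g₃ ≤ max (-z.im) 0 ∧ max (-z.im) 0 ≤ g₃ + ε) :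
    ‖z‖ ^ 2 ≤ g₀ ^ 2 + g₁ ^ 2 + g₂ ^ 2 + g₃ ^ 2 + ε * (4 + ‖z‖ ^ 2) := by
  have hz := sum_sector_sq_eq_normSq z
  have e₀ := sq_le_sq_add_of_squeeze hg₀ (le_max_right _ _) h₀.1 h₀.2
  have e₁ := sq_le_sq_add_of_squeeze hg₁ (le_max_right _ _) h₁.1 h₁.2
  have e₂ := sq_le_sq_add_of_squeeze hg₂ (le_max_right _ _) h₂.1 h₂.2
  have e₃ := sq_le_sq_add_of_squeeze hg₃ (le_max_right _ _) h₃.1 h₃.2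
  rw [← hz]
  linarith

/-- **Mass deficit.** For functions `G_j` squeezed against the phase sectors of `Ψ` at level
`ε ≥ 0`: `1 ≤ Σ_j ∫|G_j|² + ε(4|Λ_L^N| + 1)` — integrate `|Ψ|² ≤ Σ_j G_j² + ε(4·1_{Λ^N} + |Ψ|²)`
(off the box everything vanishes). [folklore] -/
theorem one_le_sum_mass_add (Ψ : TrialState N L) {G : Fin 4 → Config N → ℂ} {ε : ℝ} (hε : 0 ≤ ε)
    (hGc : ∀ j, Continuous (G j))
    (h0 : ∀ X, ‖G 0 X‖ ≤ max (Ψ.ψ X).re 0 ∧ max (Ψ.ψ X).re 0 ≤ ‖G 0 X‖ + ε)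
    (h1 : ∀ X, ‖G 1 X‖ ≤ max (-(Ψ.ψ X).re) 0 ∧ max (-(Ψ.ψ X).re) 0 ≤ ‖G 1 X‖ + ε)
    (h2 : ∀ X, ‖G 2 X‖ ≤ max (Ψ.ψ X).im 0 ∧ max (Ψ.ψ X).im 0 ≤ ‖G 2 X‖ + ε)
    (h3 : ∀ X, ‖G 3 X‖ ≤ max (-(Ψ.ψ X).im) 0 ∧ max (-(Ψ.ψ X).im) 0 ≤ ‖G 3 X‖ + ε) :
    1 ≤ (∑ j, ∫⁻ X, ((‖G j X‖₊ : ℝ≥0∞)) ^ 2) +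
      ENNReal.ofReal ε * (4 * volume (boxN N L) + 1) := by
  -- pointwise
  have hpt : ∀ X, ((‖Ψ.ψ X‖₊ : ℝ≥0∞)) ^ 2 ≤ ∑ j, ((‖G j X‖₊ : ℝ≥0∞)) ^ 2 +
      ENNReal.ofReal ε * (4 * (boxN N L).indicator 1 X + ((‖Ψ.ψ X‖₊ : ℝ≥0∞)) ^ 2) := by
    intro X
    by_cases hX : X ∈ boxN N L
    · have hr := normSq_le_of_squeeze (Ψ.ψ X) (norm_nonneg (G 0 X)) (norm_nonneg (G 1 X))
        (norm_nonneg (G 2 X)) (norm_nonneg (G 3 X)) (h0 X) (h1 X) (h2 X) (h3 X)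
      have hxe : ∑ j, ((‖G j X‖₊ : ℝ≥0∞)) ^ 2 +
          ENNReal.ofReal ε * (4 * (boxN N L).indicator 1 X + ((‖Ψ.ψ X‖₊ : ℝ≥0∞)) ^ 2) =
          ENNReal.ofReal (‖G 0 X‖ ^ 2 + ‖G 1 X‖ ^ 2 + ‖G 2 X‖ ^ 2 + ‖G 3 X‖ ^ 2 +
            ε * (4 + ‖Ψ.ψ X‖ ^ 2)) := by
        rw [Set.indicator_of_mem hX, Pi.one_apply, mul_one, Fin.sum_univ_four]
        simp only [coe_nnnorm_pow_two_eq_ofReal]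
        rw [ENNReal.ofReal_add (by positivity) (by positivity),
          ENNReal.ofReal_add (by positivity) (by positivity),
          ENNReal.ofReal_add (by positivity) (by positivity),
          ENNReal.ofReal_add (by positivity) (by positivity), ENNReal.ofReal_mul hε,
          ENNReal.ofReal_add (by positivity) (by positivity), ENNReal.ofReal_ofNat]
      rw [hxe, coe_nnnorm_pow_two_eq_ofReal]
      exact ENNReal.ofReal_le_ofReal hr
    · rw [Ψ.eq_zero X hX, nnnorm_zero, ENNReal.coe_zero, zero_pow two_ne_zero]
      exact bot_le
  -- integrate
  have hmG : ∀ j, Measurable fun X => ((‖G j X‖₊ : ℝ≥0∞)) ^ 2 := fun j =>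
    ((hGc j).measurable.nnnorm.coe_nnreal_ennreal).pow_const 2
  have hmΨ : Measurable fun X => ((‖Ψ.ψ X‖₊ : ℝ≥0∞)) ^ 2 :=
    (Ψ.contDiff.continuous.measurable.nnnorm.coe_nnreal_ennreal).pow_const 2
  have hmi : Measurable fun X => (boxN N L).indicator (1 : Config N → ℝ≥0∞) X :=
    measurable_one.indicator (measurableSet_boxN N L)
  have hm4 : Measurable fun X => (4 : ℝ≥0∞) * (boxN N L).indicator (1 : Config N → ℝ≥0∞) X :=
    hmi.const_mul 4
  have hm4Ψ : Measurable fun X =>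
      (4 : ℝ≥0∞) * (boxN N L).indicator (1 : Config N → ℝ≥0∞) X + ((‖Ψ.ψ X‖₊ : ℝ≥0∞)) ^ 2 :=
    hm4.add hmΨ
  calc (1 : ℝ≥0∞) = ∫⁻ X, ((‖Ψ.ψ X‖₊ : ℝ≥0∞)) ^ 2 := Ψ.norm_eq.symm
    _ ≤ ∫⁻ X, (∑ j, ((‖G j X‖₊ : ℝ≥0∞)) ^ 2 +
        ENNReal.ofReal ε * (4 * (boxN N L).indicator 1 X + ((‖Ψ.ψ X‖₊ : ℝ≥0∞)) ^ 2)) :=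
        lintegral_mono hpt
    _ = (∑ j, ∫⁻ X, ((‖G j X‖₊ : ℝ≥0∞)) ^ 2) +
        ENNReal.ofReal ε * (4 * volume (boxN N L) + 1) := by
        rw [lintegral_add_left (Finset.measurable_sum _ fun j _ => hmG j),
          lintegral_finsetSum _ fun j _ => hmG j, lintegral_const_mul _ hm4Ψ,
          lintegral_add_left hm4, lintegral_const_mul _ hmi,
          lintegral_indicator_one (measurableSet_boxN N L), Ψ.norm_eq]

end SectorTransfer

open SectorTransfer in
/-- **T3a — MASS DEFICIT OF THE SMOOTHED SECTORS** (registered sub-goal of T3, the ticket of this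
preliminary file): for a trial state `Ψ ∈ TrialState N L`, `ε ≥ 0` and continuous `G₀, …, G₃` squeezed
against the phase sectors of `Ψ` — `|G₀| ≤ (Re Ψ)⁺ ≤ |G₀| + ε`, `|G₁| ≤ (Re Ψ)⁻ ≤ |G₁| + ε`,
`|G₂| ≤ (Im Ψ)⁺ ≤ |G₂| + ε`, `|G₃| ≤ (Im Ψ)⁻ ≤ |G₃| + ε` — the masses satisfy
`1 ≤ Σ_j ∫|G_j|² + ε (4|Λ_L^N| + 1)` (`= one_le_sum_mass_add`). [folklore] -/
theorem stub_sectorMassDeficit :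
    ∀ (N : ℕ) (L : ℝ) (Ψ : Literature.MathematicalPhysics.QuantumManyBody.BoseGas.TrialState N L) (G : Fin 4 → (Literature.MathematicalPhysics.QuantumManyBody.BoseGas.Config N → ℂ)) (ε : ℝ), 0 ≤ ε → (∀ j, Continuous (G j)) → (∀ X, ‖G 0 X‖ ≤ max (Ψ.ψ X).re 0 ∧ max (Ψ.ψ X).re 0 ≤ ‖G 0 X‖ + ε) → (∀ X, ‖G 1 X‖ ≤ max (-(Ψ.ψ X).re) 0 ∧ max (-(Ψ.ψ X).re) 0 ≤ ‖G 1 X‖ + ε) → (∀ X, ‖G 2 X‖ ≤ max (Ψ.ψ X).im 0 ∧ max (Ψ.ψ X).im 0 ≤ ‖G 2 X‖ + ε) → (∀ X, ‖G 3 X‖ ≤ max (-(Ψ.ψ X).im) 0 ∧ max (-(Ψ.ψ X).im) 0 ≤ ‖G 3 X‖ + ε) → 1 ≤ (∑ j, ∫⁻ X, (‖G j X‖₊ : ENNReal) ^ 2) + ENNReal.ofReal ε * (4 * MeasureTheory.volume (Literature.MathematicalPhysics.QuantumManyBody.BoseGas.boxN N L) + 1) :=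
  fun _ _ Ψ _ _ hε hGc h0 h1 h2 h3 => one_le_sum_mass_add Ψ hε hGc h0 h1 h2 h3

end Summit.AtomisticToContinuum.BoseEinsteinCondensation.Cruxes.HardSphereBEC.Birth

end
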